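import Mathlib.Topology.Algebra.MvPolynomial
import Mathlib.LinearAlgebra.FreeModule.PID
import Mathlib.RingTheory.Finiteness.Prod
import Literature.NumberTheory.DiophantineGeometry.AVIsogenyTateHomProofs
import Literature.NumberTheory.DiophantineGeometry.AVKernelHopf
import HarnessLib

/-!
# `Hom(A, B)` finitely generated (Mumford §19, Theorem 3): Step I from the degree function

Third part of the proof files for the named fact
`Literature.AlgebraicGeometry.Motives.AbelianVariety.module_finite_hom` of `AVIsogenyTate`
(`Hom(A, B)` is finitely generated; Mumford, *Abelian Varieties*, §19, Theorem 3; Milne 1986,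
Theorem 12.5), after `AVIsogenyTateHomProofs` (Step III, the discreteness lemma `fg_of_norm`) and
beside `AVIsogenyTateHomStepIIProofs` (Step II and the reduction of the fact to Step I plus the
torsion counts).

**Step I for the endomorphism ring of a simple abelian variety** (Mumford §19, proof of Thm. 3,
first step; Milne 1986, Lemma 12.7 and its statement `(*)`): if `X` is simple, every non-zero
endomorphism is an isogeny, so `deg φ ≥ 1` for `φ ≠ 0`, and `deg` is (the restriction of) a
homogeneous polynomial function of degree `2 dim X` on `End⁰(X) = ℚ ⊗ End(X)` (Mumford §19,
Thm. 2; Milne 1986, Prop. 12.4); hence for a finitely generated `M ≤ End(X)` the saturation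
`ℚM ∩ End(X)` is discrete in `ℝM` and finitely generated. The geometric inputs — simplicity and
the degree theorem — are **hypotheses** here (the tree has neither Poincaré's reducibility
theorem nor intersection degrees); what is proved is the deduction:

* `exists_fg_of_homogeneous_norm` — the deduction for an abstract abelian group `H` carrying an
  integer-valued function `deg` with `deg 0 = 0`, `deg φ ≥ 1` for `φ ≠ 0`, whose values on the
  integer combinations of any finite family are given by a rational polynomial that is a
  homogeneous function of a fixed degree `d`: `H` is then torsion-free and the saturation of every
  finitely generated subgroup is finitely generated (via `fg_of_norm`);
* `AbelianVariety.exists_fg_saturation_end_of_degree` — the same for `H = End(X)`,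
  `deg φ = [order of Ker φ]` for isogenies and `0` otherwise, under the hypotheses "every non-zero
  endomorphism of `X` is an isogeny, `0` is not" (simplicity, `dim X > 0`) and Mumford §19 Thm. 2
  for `X`;
* `exists_fg_saturation_of_injective`, `exists_fg_saturation_prod`,
  `exists_fg_saturation_of_forall_eq_zero` — the conclusion ("the saturation of every finitely
  generated subgroup lies in a finitely generated subgroup") passes to subgroups, binary products
  and holds for the zero group (used by the reduction of the general case to the simple case,
  `AVIsogenyTateHomPoincareProofs`).

The consequences for `module_finite_hom` (`End(X)` finitely generated for such `X`; the general
case via Poincaré's complete reducibility theorem, Mumford §19 Thm. 1) are assembled in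
`AVIsogenyTateHomPoincareProofs`.

## References

* [MumfordAV1970] D. Mumford, *Abelian Varieties*, §19, Theorems 2 and 3 (pp. 174–178 of the
  2nd ed.). Not held; architecture as in Milne 1986.
* [Milne1986AbelianVarieties] J. S. Milne, *Abelian Varieties*, in Cornell–Silverman (eds.),
  *Arithmetic Geometry*, Springer 1986, §12: Prop. 12.4, Lemma 12.7 with `(*)` (held:
  `book:cornellnd-arithmetic-geometry`, PDF pp. 190–191).

## Design

No definitions, no named facts. "Homogeneous polynomial function of degree `d`" is spelled as in
Milne's definition (a function given on coordinates by a polynomial), with homogeneity as the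
functional equation `F(t q) = t^d F(q)` of the polynomial's values (equivalent to
`MvPolynomial.IsHomogeneous` over the infinite field `ℚ`, and exactly what the discreteness
argument consumes). The degree of an endomorphism is written inline,
`if IsIsogeny φ then Hom.kerRank φ else 0` (`Hom.kerRank` = `dim_K Γ(Ker φ, 𝒪)`, the order of the
kernel group scheme, is the degree of an isogeny: `IsIsogeny.kerRank_eq_finrank_functionFieldOver`).
-/

universe u

open CategoryTheory MvPolynomial

noncomputable section

namespace Literature.NumberTheory.DiophantineGeometry

/-! ### The deduction for an abstract group with a homogeneous polynomial norm -/

section Norm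

variable {H : Type*} [AddCommGroup H]

/-- A rational polynomial whose values form a homogeneous function of degree `d` scales by `m^d`
on integer points: `F(m n) = m^d F(n)`. [folklore] -/
theorem eval_intCast_smul_of_homogeneous {r d : ℕ} {F : MvPolynomial (Fin r) ℚ}
    (hF : ∀ (t : ℚ) (q : Fin r → ℚ), eval (t • q) F = t ^ d * eval q F) (m : ℤ) (n : Fin r → ℤ) :
    eval (fun i => ((m * n i : ℤ) : ℚ)) F = (m : ℚ) ^ d * eval (fun i => (n i : ℚ)) F := by
  have h : (fun i => ((m * n i : ℤ) : ℚ)) = (m : ℚ) • fun i => (n i : ℚ) := by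
    funext i
    simp [Pi.smul_apply, smul_eq_mul]
  rw [h, hF]

/-- **Torsion-freeness from a homogeneous polynomial norm.** If `deg : H → ℤ` vanishes at `0`,
is `≥ 1` off `0`, and along every cyclic subgroup `ℤφ` is given by a rational polynomial whose
values are homogeneous of degree `d`, then `H` is torsion-free: `n φ = 0` with `n ≠ 0`, `φ ≠ 0`
would give `0 = deg (n φ) = n^d deg φ ≠ 0`. (Mumford §19, Thm. 3: `End(X)` is torsion-free;
there from §6 App. 2.) [folklore] -/
theorem noZeroSMulDivisors_int_of_homogeneous_norm (d : ℕ) (deg : H → ℤ) (h0 : deg 0 = 0)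
    (hpos : ∀ φ : H, φ ≠ 0 → 1 ≤ deg φ)
    (hpoly : ∀ (r : ℕ) (e : Fin r → H), ∃ F : MvPolynomial (Fin r) ℚ,
      (∀ (t : ℚ) (q : Fin r → ℚ), eval (t • q) F = t ^ d * eval q F) ∧
      ∀ n : Fin r → ℤ, (deg (∑ i, n i • e i) : ℚ) = eval (fun i => (n i : ℚ)) F) :
    NoZeroSMulDivisors ℤ H := by
  refine ⟨fun {n φ} h => ?_⟩
  by_contra hc
  obtain ⟨hn, hφ⟩ := not_or.1 hc
  obtain ⟨F, hF, hval⟩ := hpoly 1 ![φ]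
  have h1 : (deg φ : ℚ) = eval (fun _ => ((1 : ℤ) : ℚ)) F := by
    have := hval fun _ => 1
    simpa using this
  have hnφ : (deg (n • φ) : ℚ) = (n : ℚ) ^ d * deg φ := by
    have := hval fun _ => n
    simp only [Fin.sum_univ_one, Matrix.cons_val_fin_one] at this
    rw [this, h1, ← eval_intCast_smul_of_homogeneous hF n fun _ => 1]
    simp
  rw [h, h0, Int.cast_zero] at hnφ
  have h2 : (1 : ℚ) ≤ deg φ := by exact_mod_cast hpos φ hφ
  have h3 : (n : ℚ) ^ d ≠ 0 := pow_ne_zero _ (Int.cast_ne_zero.2 hn)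
  have : (n : ℚ) ^ d * deg φ ≠ 0 := mul_ne_zero h3 (by linarith)
  exact this hnφ.symm

/-- **Step I of Mumford's proof of §19 Thm. 3 / statement `(*)` of Milne 1986, Lemma 12.7, as
algebra.** Let `deg : H → ℤ` vanish at `0`, be `≥ 1` at every non-zero element, and be given on
the integer combinations `∑ nᵢ eᵢ` of any finite family `e` by a rational polynomial `F_e` whose
values are homogeneous of degree `d` (`deg` "extends to a homogeneous polynomial function of degree
`d` on `ℚ ⊗ H`"). Then the saturation `{φ | n φ ∈ M, some n ≠ 0}` of every finitely generated
subgroup `M ≤ H` lies in (indeed is) a finitely generated subgroup. Proof as printed: `H` is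
torsion-free, `M` is free with a finite basis `b`, and in the rational coordinates of the saturation
`deg = F_b` is continuous, vanishes at `0` and is `≥ 1` off `0`, so the saturation is discrete in
`ℝ^ι` and finitely generated (`fg_of_norm`). In the source `H = End(X)` for a simple abelian
variety `X`. [cite: Milne1986AbelianVarieties, Lemma 12.7 (proof, statement (*), PDF p. 191)] -/
theorem exists_fg_of_homogeneous_norm (d : ℕ) (deg : H → ℤ) (h0 : deg 0 = 0)
    (hpos : ∀ φ : H, φ ≠ 0 → 1 ≤ deg φ)
    (hpoly : ∀ (r : ℕ) (e : Fin r → H), ∃ F : MvPolynomial (Fin r) ℚ,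
      (∀ (t : ℚ) (q : Fin r → ℚ), eval (t • q) F = t ^ d * eval q F) ∧
      ∀ n : Fin r → ℤ, (deg (∑ i, n i • e i) : ℚ) = eval (fun i => (n i : ℚ)) F)
    (M : Submodule ℤ H) (hM : M.FG) :
    ∃ S : Submodule ℤ H, S.FG ∧ ∀ φ : H, (∃ n : ℤ, n ≠ 0 ∧ n • φ ∈ M) → φ ∈ S := by
  haveI : NoZeroSMulDivisors ℤ H := noZeroSMulDivisors_int_of_homogeneous_norm d deg h0 hpos hpoly
  haveI : Module.Finite ℤ M := Module.Finite.iff_fg.2 hM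
  haveI : Module.Free ℤ M := Module.free_of_finite_type_torsion_free'
  -- a finite basis of `M` and the polynomial of the family
  set r := Module.finrank ℤ M with hr
  let b : Module.Basis (Fin r) ℤ M := Module.finBasis ℤ M
  obtain ⟨F, hF, hval⟩ := hpoly r fun i => (b i : H)
  -- the saturation of `M`
  let S : Submodule ℤ H :=
    { carrier := {φ | ∃ n : ℤ, n ≠ 0 ∧ n • φ ∈ M}
      add_mem' := by
        rintro f g ⟨n, hn, hf⟩ ⟨m, hm, hg⟩
        refine ⟨m * n, mul_ne_zero hm hn, ?_⟩
        rw [smul_add]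
        refine M.add_mem ?_ ?_
        · rw [mul_smul]; exact M.smul_mem m hf
        · rw [mul_comm, mul_smul]; exact M.smul_mem n hg
      zero_mem' := ⟨1, one_ne_zero, by rw [smul_zero]; exact M.zero_mem⟩
      smul_mem' := by
        rintro c f ⟨n, hn, hf⟩
        exact ⟨n, hn, by rw [smul_comm]; exact M.smul_mem c hf⟩ }
  have hSmem : ∀ φ : H, φ ∈ S ↔ ∃ n : ℤ, n ≠ 0 ∧ n • φ ∈ M := fun φ => Iff.rfl
  refine ⟨S, ?_, fun φ hφ => (hSmem φ).2 hφ⟩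
  -- the real polynomial function
  let Fℝ : (Fin r → ℝ) → ℝ := fun x => eval x (map (algebraMap ℚ ℝ) F)
  have hFℝ : ∀ q : Fin r → ℚ, ((eval q F : ℚ) : ℝ) = Fℝ fun i => (q i : ℝ) := fun q => by
    simp only [Fℝ, eval_map]
    exact hom_eval₂ F (RingHom.id ℚ) (algebraMap ℚ ℝ) q
  have hcont : Continuous Fℝ := continuous_eval _
  -- value of `deg` on `M` in coordinates
  have hvalM : ∀ y : M, (deg (y : H) : ℚ) = eval (fun i => (b.repr y i : ℚ)) F := fun y => by
    have hy : (y : H) = ∑ i, b.repr y i • (b i : H) := by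
      conv_lhs => rw [← b.sum_repr y]
      rw [Submodule.coe_sum]
      simp only [Submodule.coe_smul]
    rw [← hval fun i => b.repr y i, ← hy]
  have hF0 : Fℝ 0 < 1 := by
    have h2 : eval (fun _ : Fin r => (0 : ℚ)) F = 0 := by
      have h := hvalM 0
      simp only [Submodule.coe_zero, h0, Int.cast_zero, map_zero, Finsupp.coe_zero,
        Pi.zero_apply] at h
      exact h.symm
    have h' : Fℝ 0 = ((eval (fun _ : Fin r => (0 : ℚ)) F : ℚ) : ℝ) := by
      rw [hFℝ]
      simp only [Rat.cast_zero]
      rfl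
    rw [h', h2, Rat.cast_zero]
    exact zero_lt_one
  -- homogeneity along `ℤφ`: `deg (m φ) = m^d deg φ`
  have hscale : ∀ (φ : H) (m : ℤ), (deg (m • φ) : ℚ) = (m : ℚ) ^ d * deg φ := fun φ m => by
    obtain ⟨F₁, hF₁, hval₁⟩ := hpoly 1 ![φ]
    have h1 : (deg φ : ℚ) = eval (fun _ => ((1 : ℤ) : ℚ)) F₁ := by
      simpa using hval₁ fun _ => 1
    have := hval₁ fun _ => m
    simp only [Fin.sum_univ_one, Matrix.cons_val_fin_one] at this
    rw [this, h1, ← eval_intCast_smul_of_homogeneous hF₁ m fun _ => 1]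
    simp
  refine fg_of_norm M S b (fun φ hφ => (hSmem φ).1 hφ) deg Fℝ hcont hF0
    (fun φ _ hφ => hpos φ hφ) fun φ _ m y hm hy => ?_
  -- `deg φ = F (repr y / m)` for `m φ = y`
  have hm' : (m : ℚ) ≠ 0 := Int.cast_ne_zero.2 hm
  have hq : (deg φ : ℚ) = eval (fun i => (b.repr y i : ℚ) / m) F := by
    have h1 : (deg (m • φ) : ℚ) = eval (fun i => (b.repr y i : ℚ)) F := by rw [hy]; exact hvalM y
    have h2 : eval (fun i => (b.repr y i : ℚ)) F =
        (m : ℚ) ^ d * eval (fun i => (b.repr y i : ℚ) / m) F := by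
      have h3 : (fun i => (b.repr y i : ℚ)) = (m : ℚ) • fun i => (b.repr y i : ℚ) / m := by
        funext i
        simp only [Pi.smul_apply, smul_eq_mul]
        field_simp
      rw [h3, hF]
    rw [hscale, h2] at h1
    exact mul_left_cancel₀ (pow_ne_zero _ hm') h1
  have hcast : ((deg φ : ℚ) : ℝ) = (deg φ : ℝ) := Rat.cast_intCast _
  rw [← hcast, hq, hFℝ]
  congr 1
  funext i
  push_cast
  ring

end Norm

/-! ### The saturation property under injections and products -/

section Algebra

variable {H H' : Type*} [AddCommGroup H] [AddCommGroup H']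

/-- The property "the saturation of every finitely generated subgroup lies in a finitely generated
subgroup" passes to subgroups: pull back along an injective additive map (`ℤ` is noetherian, so the
preimage of a finitely generated subgroup meeting the image is finitely generated). [folklore] -/
theorem exists_fg_saturation_of_injective (e : H →ₗ[ℤ] H') (he : Function.Injective e)
    (h' : ∀ M' : Submodule ℤ H', M'.FG →
      ∃ S' : Submodule ℤ H', S'.FG ∧ ∀ x : H', (∃ n : ℤ, n ≠ 0 ∧ n • x ∈ M') → x ∈ S')
    (M : Submodule ℤ H) (hM : M.FG) :
    ∃ S : Submodule ℤ H, S.FG ∧ ∀ x : H, (∃ n : ℤ, n ≠ 0 ∧ n • x ∈ M) → x ∈ S := by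
  obtain ⟨S', hS'fg, hS'⟩ := h' (M.map e) (hM.map e)
  refine ⟨S'.comap e, ?_, ?_⟩
  · apply Submodule.fg_of_fg_map_injective e he
    haveI : Module.Finite ℤ S' := Module.Finite.iff_fg.2 hS'fg
    have h := (IsNoetherian.noetherian (R := ℤ) (M := S')
      ((Submodule.map e (S'.comap e)).comap S'.subtype)).map S'.subtype
    rwa [Submodule.map_comap_subtype, inf_eq_right.2 (Submodule.map_comap_le e S')] at h
  · rintro x ⟨n, hn, hx⟩
    exact hS' (e x) ⟨n, hn, by rw [← map_zsmul]; exact Submodule.mem_map_of_mem hx⟩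

/-- The saturation property passes to binary products. [folklore] -/
theorem exists_fg_saturation_prod
    (h₁ : ∀ M : Submodule ℤ H, M.FG →
      ∃ S : Submodule ℤ H, S.FG ∧ ∀ x : H, (∃ n : ℤ, n ≠ 0 ∧ n • x ∈ M) → x ∈ S)
    (h₂ : ∀ M : Submodule ℤ H', M.FG →
      ∃ S : Submodule ℤ H', S.FG ∧ ∀ x : H', (∃ n : ℤ, n ≠ 0 ∧ n • x ∈ M) → x ∈ S)
    (M : Submodule ℤ (H × H')) (hM : M.FG) :
    ∃ S : Submodule ℤ (H × H'), S.FG ∧ ∀ x : H × H', (∃ n : ℤ, n ≠ 0 ∧ n • x ∈ M) → x ∈ S := by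
  obtain ⟨S₁, hS₁, hS₁'⟩ := h₁ (M.map (LinearMap.fst ℤ H H')) (hM.map _)
  obtain ⟨S₂, hS₂, hS₂'⟩ := h₂ (M.map (LinearMap.snd ℤ H H')) (hM.map _)
  refine ⟨S₁.prod S₂, hS₁.prod hS₂, ?_⟩
  rintro ⟨x₁, x₂⟩ ⟨n, hn, hx⟩
  exact ⟨hS₁' x₁ ⟨n, hn, Submodule.mem_map.2 ⟨_, hx, rfl⟩⟩,
    hS₂' x₂ ⟨n, hn, Submodule.mem_map.2 ⟨_, hx, rfl⟩⟩⟩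

/-- The saturation property holds trivially for the zero group. [folklore] -/
theorem exists_fg_saturation_of_forall_eq_zero (h : ∀ x : H, x = 0) (M : Submodule ℤ H) (_hM : M.FG) :
    ∃ S : Submodule ℤ H, S.FG ∧ ∀ x : H, (∃ n : ℤ, n ≠ 0 ∧ n • x ∈ M) → x ∈ S :=
  ⟨⊥, Submodule.fg_bot, fun x _ => by rw [h x]; exact Submodule.zero_mem _⟩

end Algebra

/-! ### `End(X)` for `X` simple, granted Mumford §19 Thm. 2 -/

section AbelianVariety
open Literature.AlgebraicGeometry.Motives (AbelianVariety)
open Literature.AlgebraicGeometry.Motives.AbelianVariety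

variable {K : Type u} [Field K] (X : AbelianVariety K)

open Classical in
/-- **Step I of Mumford's proof of §19 Thm. 3 for `End(X)`, `X` simple, granted §19 Thm. 2.**
Suppose every non-zero endomorphism of `X` is an isogeny while `0` is not (`X` simple of positive
dimension; Mumford §19, Cor. 2 of Thm. 1; Milne 1986, proof of Lemma 12.7: "every nonzero element
of End(A) is an isogeny"), and that the degree `φ ↦ deg φ` (`= ord Ker φ` for isogenies, `0`
otherwise) is, on the integer combinations of every finite family of endomorphisms, a rational
polynomial whose values are homogeneous of degree `2 dim X` (Mumford §19, Thm. 2; Milne 1986,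
Prop. 12.4: "`deg` extends to a homogeneous polynomial function of degree `2g` on `End⁰(X)`").
Then the saturation `ℚM ∩ End(X)` of every finitely generated `M ≤ End(X)` lies in a finitely
generated subgroup (Milne 1986, Lemma 12.7, `(*)`; Mumford §19, proof of Thm. 3, first step).
[cite: Milne1986AbelianVarieties, Lemma 12.7 (proof, statement (*), PDF p. 191)] -/
theorem _root_.Literature.AlgebraicGeometry.Motives.AbelianVariety.exists_fg_saturation_end_of_degree
    (hiso : ∀ φ : X ⟶ X, φ ≠ 0 → IsIsogeny φ) (h0 : ¬ IsIsogeny (0 : X ⟶ X))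
    (hdeg : ∀ (r : ℕ) (e : Fin r → (X ⟶ X)), ∃ F : MvPolynomial (Fin r) ℚ,
      (∀ (t : ℚ) (q : Fin r → ℚ), eval (t • q) F = t ^ (2 * X.dim) * eval q F) ∧
      ∀ n : Fin r → ℤ,
        ((if IsIsogeny (∑ i, n i • e i) then (Hom.kerRank (∑ i, n i • e i) : ℤ) else 0 : ℤ) : ℚ) =
          eval (fun i => (n i : ℚ)) F)
    (M : Submodule ℤ (X ⟶ X)) (hM : M.FG) :
    ∃ S : Submodule ℤ (X ⟶ X), S.FG ∧ ∀ φ : X ⟶ X, (∃ n : ℤ, n ≠ 0 ∧ n • φ ∈ M) → φ ∈ S := by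
  refine exists_fg_of_homogeneous_norm (2 * X.dim)
    (fun φ => if IsIsogeny φ then (Hom.kerRank φ : ℤ) else 0) (by simp [h0]) (fun φ hφ => ?_)
    hdeg M hM
  rw [if_pos (hiso φ hφ)]
  haveI := (hiso φ hφ).2
  exact_mod_cast Hom.kerRank_pos φ

end AbelianVariety

end Literature.NumberTheory.DiophantineGeometry
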